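import Mathlib.NumberTheory.Padics.RingHoms
import Mathlib.GroupTheory.OrderOfElement
import Mathlib.RingTheory.LocalRing.Basic
import HarnessLib

/-!
# Unit-root congruences: an endomorphism of a cyclic group of order `p^k` satisfying Manin's relation
# `f² − a f + p = 0` acts as the UNIT ROOT of `X² − aX + p` modulo `p^k`
# (pure algebra toward FILE 1 (1a) of the hLine plan; records stmt-BirchSwinnertonDyer-19668 / -19669)

Seat `bsd-schneider-door-c4` (cell `bsd-schneider-ideate`), gen 5; route `SchneiderFreeAdditiveX3`.
The one open in-tree input of the control corner's records is the unit-root Frobenius character of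
Greenberg's reduction line (FILE 1); its «quotient half» (1a) says that an element of Frobenius degree
`n` acts on `Ẽ[p^k]` as `α^n`, `α` the unit root of `X² − a_pX + p` — at level `k = 1` this is the
tree's `frob_smul_eq_frobeniusTrace_smul_of_zsmul_eq_zero` (`φ = a_p` on `Ẽ[p]`), whose docstring
records that «on `Ẽ[p^k]`, `k ≥ 2`, the Frobenius is the unit root of `X² − a_pX + p`, congruent to
`a_p` only modulo `p`; not needed here».  This file supplies the missing ALGEBRA of all levels, free of
any curve or Galois plumbing:

* §1 `sub_unitRoot_mem_span_pow` — in `ℤ_p`: if `α` is a unit with `α² = aα − p` and `u` is a unit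
  with `u² − au + p ≡ 0 (mod p^k)`, then `u ≡ α (mod p^k)` (the other root `β = a − α = p/α` lies in
  `pℤ_p`, so `u − β` is a unit and `(u − α)(u − β) ≡ 0` forces `u ≡ α`); `pow_sub_pow_mem_span_pow`
  (`u ≡ α ⇒ uⁿ ≡ αⁿ`); `int_dvd_of_sub_mem_span_pow` (back to `ℤ`).
* §2 `exists_int_smul_of_mem_zmultiples` / `dvd_of_manin` / `not_dvd_of_injective` — an additive
  endomorphism `f` stabilising the cyclic group `⟨R₀⟩`, `ord R₀ = p^k`, acts on it by an integer `u`;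
  Manin's relation `f(fR) − a•fR + p•R = 0` on `⟨R₀⟩` gives `p^k ∣ u² − au + p`; injectivity of `f`
  on `⟨R₀⟩` (`k ≥ 1`) gives `p ∤ u`.
* §3 **`iterate_eq_zsmul_of_manin`** — hence `f^[n] R = N • R` on `⟨R₀⟩` for every `N ≡ αⁿ
  (mod p^k)`: the shape in which (1a) is consumed (`f` = the `p`-power Frobenius on the reduced curve,
  `R₀` a generator of the cyclic `Ẽ[p^k]` at a good ORDINARY prime).

Proofs only (no definition, no named fact, no `sorry`); Mathlib-only imports; closes nothing by
itself; BSD is not advanced.  References: [SilvermanAEC2009] V.2.3.1 (Manin's relation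
`φ² − aφ + p = 0`); [MazurTateTeitelbaum1986Invent] §I.11 (the unit root); [GreenbergLNM1716] §2 p. 70.
-/

noncomputable section

open scoped Classical

namespace Summit.BirchSwinnertonDyer.BirchSwinnertonDyer.Theorems.SchneiderFreeAdditiveX3

set_option linter.dupNamespace false

/-! ## §1. The unit root modulo `p^k` -/

section Padic

variable {p : ℕ} [hp : Fact p.Prime]

/-- **Uniqueness of the unit root modulo `p^k`.**  If `α ∈ ℤ_pˣ` satisfies `α² = aα − p` and a unit
`u ∈ ℤ_p` satisfies `u² − au + p ∈ (p^k)`, then `u − α ∈ (p^k)`: with `β := a − α` one has `αβ = p`,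
so `β = p α⁻¹ ∈ pℤ_p`, `u − β` is a unit of the local ring `ℤ_p`, and
`(u − α)(u − β) = u² − au + p ∈ (p^k)`. [cite: MazurTateTeitelbaum1986Invent, §I.11] -/
theorem sub_unitRoot_mem_span_pow (a : ℤ) (α : ℤ_[p]ˣ) (hα : ((α : ℤ_[p])) ^ 2 = a * (α : ℤ_[p]) - p)
    {u : ℤ_[p]} (hu : IsUnit u) {k : ℕ}
    (h : u ^ 2 - a * u + p ∈ (Ideal.span {(p : ℤ_[p]) ^ k} : Ideal ℤ_[p])) :
    u - α ∈ (Ideal.span {(p : ℤ_[p]) ^ k} : Ideal ℤ_[p]) := by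
  set β : ℤ_[p] := a - α with hβ
  have hαβ : (α : ℤ_[p]) * β = p := by rw [hβ, mul_sub, ← sq, hα]; ring
  have hfac : u ^ 2 - a * u + p = (u - α) * (u - β) := by rw [← hαβ, hβ]; ring
  -- `β ∈ pℤ_p`, so `u - β` is a unit
  have hβp : β = p * (↑α⁻¹ : ℤ_[p]) := by
    have : (α : ℤ_[p]) * (β - p * ↑α⁻¹) = 0 := by
      rw [mul_sub, hαβ, ← mul_assoc, mul_comm (α : ℤ_[p]), mul_assoc, Units.mul_inv, mul_one, sub_self]
    have h0 := (mul_eq_zero.mp this).resolve_left (Units.ne_zero α)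
    exact sub_eq_zero.mp h0
  have hβmem : β ∈ IsLocalRing.maximalIdeal ℤ_[p] := by
    rw [hβp, PadicInt.maximalIdeal_eq_span_p]
    exact Ideal.mul_mem_right _ _ (Ideal.mem_span_singleton_self _)
  have huβ : IsUnit (u - β) := by
    obtain ⟨w, rfl⟩ := hu
    have h1 : (w : ℤ_[p]) - β = w * (1 - ↑w⁻¹ * β) := by
      rw [mul_sub, mul_one, ← mul_assoc, Units.mul_inv, one_mul]
    rw [h1]
    refine (Units.isUnit w).mul ?_
    have hm : ↑w⁻¹ * β ∈ IsLocalRing.maximalIdeal ℤ_[p] := Ideal.mul_mem_left _ _ hβmem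
    exact IsLocalRing.isUnit_one_sub_self_of_mem_nonunits _ hm
  rw [hfac] at h
  obtain ⟨w, hw⟩ := huβ
  rw [← hw] at h
  exact (Ideal.mul_unit_mem_iff_mem _ (Units.isUnit w)).mp h

/-- `u ≡ α (mod p^k)` implies `uⁿ ≡ αⁿ (mod p^k)`. [folklore] -/
theorem pow_sub_pow_mem_span_pow {u w : ℤ_[p]} {k : ℕ}
    (h : u - w ∈ (Ideal.span {(p : ℤ_[p]) ^ k} : Ideal ℤ_[p])) (n : ℕ) :
    u ^ n - w ^ n ∈ (Ideal.span {(p : ℤ_[p]) ^ k} : Ideal ℤ_[p]) := by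
  rw [← Ideal.Quotient.eq] at h ⊢
  rw [map_pow, map_pow, h]

/-- Back to `ℤ`: for integers `m, N`, `(m : ℤ_p) − N ∈ (p^k)` iff `p^k ∣ m − N` in `ℤ`. [folklore] -/
theorem int_dvd_of_sub_mem_span_pow {m N : ℤ} {k : ℕ}
    (h : (m : ℤ_[p]) - (N : ℤ_[p]) ∈ (Ideal.span {(p : ℤ_[p]) ^ k} : Ideal ℤ_[p])) :
    ((p ^ k : ℕ) : ℤ) ∣ m - N := by
  have h1 : PadicInt.toZModPow k ((m : ℤ_[p]) - (N : ℤ_[p])) = 0 := by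
    rw [← RingHom.mem_ker, PadicInt.ker_toZModPow]; exact h
  rw [map_sub, map_intCast, map_intCast, sub_eq_zero, ZMod.intCast_eq_intCast_iff_dvd_sub] at h1
  rw [← Int.dvd_neg, neg_sub]
  exact h1

end Padic

/-! ## §2. An endomorphism of a cyclic group of order `p^k` -/

section Cyclic

variable {M : Type*} [AddCommGroup M] (f : M →+ M) {p : ℕ} [hp : Fact p.Prime]

/-- An additive endomorphism stabilising the cyclic group `⟨R₀⟩` acts on it by an integer. [folklore] -/
theorem exists_int_smul_of_mem_zmultiples (R₀ : M) (hf : f R₀ ∈ AddSubgroup.zmultiples R₀) :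
    ∃ u : ℤ, ∀ R ∈ AddSubgroup.zmultiples R₀, f R = u • R := by
  obtain ⟨u, hu⟩ := AddSubgroup.mem_zmultiples_iff.mp hf
  refine ⟨u, fun R hR => ?_⟩
  obtain ⟨j, rfl⟩ := AddSubgroup.mem_zmultiples_iff.mp hR
  rw [map_zsmul, ← hu, smul_comm]

omit hp in
/-- **Manin's relation gives the congruence.**  If `f` acts on `⟨R₀⟩` (`ord R₀ = p^k`) by the
integer `u` and `f(fR) − a•fR + p•R = 0` on `⟨R₀⟩`, then `p^k ∣ u² − au + p`.
[cite: SilvermanAEC2009, Thm. V.2.3.1(b)] -/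
theorem dvd_of_manin {R₀ : M} {k : ℕ} (hR₀ : addOrderOf R₀ = p ^ k) (a : ℤ) {u : ℤ}
    (hu : ∀ R ∈ AddSubgroup.zmultiples R₀, f R = u • R)
    (hrel : ∀ R ∈ AddSubgroup.zmultiples R₀, f (f R) - a • f R + (p : ℤ) • R = 0) :
    ((p ^ k : ℕ) : ℤ) ∣ u ^ 2 - a * u + p := by
  have hmem : R₀ ∈ AddSubgroup.zmultiples R₀ := AddSubgroup.mem_zmultiples R₀
  have hfR₀ : f R₀ ∈ AddSubgroup.zmultiples R₀ := by
    rw [hu R₀ hmem]; exact AddSubgroup.zsmul_mem _ hmem u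
  have h := hrel R₀ hmem
  rw [hu _ hfR₀, hu R₀ hmem, smul_smul, smul_smul, ← sub_smul, ← add_smul] at h
  rw [← hR₀, addOrderOf_dvd_iff_zsmul_eq_zero]
  convert h using 2
  ring

/-- **Injectivity gives a unit.**  If `f` acts on `⟨R₀⟩` (`ord R₀ = p^k`, `k ≥ 1`) by the integer
`u` and is injective on `⟨R₀⟩`, then `p ∤ u` (else `f(p^{k-1}R₀) = (u/p)·p^k R₀ = 0`). [folklore] -/
theorem not_dvd_of_injective {R₀ : M} {k : ℕ} (hk : 1 ≤ k) (hR₀ : addOrderOf R₀ = p ^ k) {u : ℤ}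
    (hu : ∀ R ∈ AddSubgroup.zmultiples R₀, f R = u • R)
    (hinj : ∀ R ∈ AddSubgroup.zmultiples R₀, f R = 0 → R = 0) : ¬ (p : ℤ) ∣ u := by
  rintro ⟨c, rfl⟩
  set R₁ : M := ((p ^ (k - 1) : ℕ) : ℤ) • R₀ with hR₁
  have hR₁mem : R₁ ∈ AddSubgroup.zmultiples R₀ := AddSubgroup.zsmul_mem _ (AddSubgroup.mem_zmultiples R₀) _
  have hfR₁ : f R₁ = 0 := by
    rw [hu R₁ hR₁mem, hR₁, smul_smul]
    have : (p : ℤ) * c * ((p ^ (k - 1) : ℕ) : ℤ) = c * ((p ^ k : ℕ) : ℤ) := by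
      have hk' : k = (k - 1) + 1 := by omega
      conv_rhs => rw [hk', pow_succ]
      push_cast; ring
    rw [this, mul_smul, ← hR₀, natCast_zsmul, addOrderOf_nsmul_eq_zero, smul_zero]
  have hR₁0 : R₁ = 0 := hinj R₁ hR₁mem hfR₁
  -- but `p^{k-1} R₀ ≠ 0` since `ord R₀ = p^k`
  have hlt : p ^ (k - 1) < p ^ k := Nat.pow_lt_pow_right hp.out.one_lt (by omega)
  have hne : (p ^ (k - 1)) • R₀ ≠ 0 := by
    intro h0
    have hdvd := addOrderOf_dvd_of_nsmul_eq_zero h0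
    rw [hR₀] at hdvd
    exact absurd (Nat.le_of_dvd (pow_pos hp.out.pos _) hdvd) (not_le.mpr hlt)
  rw [hR₁, natCast_zsmul] at hR₁0
  exact hne hR₁0

/-- Iterates of `f` act on `⟨R₀⟩` by powers of `u`. [folklore] -/
theorem iterate_eq_pow_smul {R₀ : M} {u : ℤ} (hu : ∀ R ∈ AddSubgroup.zmultiples R₀, f R = u • R)
    (n : ℕ) : ∀ R ∈ AddSubgroup.zmultiples R₀, f^[n] R = u ^ n • R := by
  induction n with
  | zero => intro R _; simp
  | succ n ih =>
    intro R hR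
    rw [Function.iterate_succ_apply', ih R hR, map_zsmul, hu R hR, smul_smul, pow_succ, mul_comm]

end Cyclic

/-! ## §3. The iterates act as powers of the unit root -/

section Iterate

variable {M : Type*} [AddCommGroup M] (f : M →+ M) {p : ℕ} [hp : Fact p.Prime]

/-- **An endomorphism of a cyclic group of order `p^k` satisfying Manin's relation acts, through its
`n`-th iterate, as `αⁿ` modulo `p^k`**, `α ∈ ℤ_pˣ` the unit root of `X² − aX + p`: for `f` stabilising
`⟨R₀⟩` (`ord R₀ = p^k`), injective on it, with `f(fR) − a•fR + p•R = 0` on `⟨R₀⟩`, and every integer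
`N ≡ αⁿ (mod p^k)`: `f^[n] R = N • R` for all `R ∈ ⟨R₀⟩`.  (The consumer: `f` = the `p`-power
Frobenius on the reduction `Ẽ` at a good ORDINARY prime, `R₀` a generator of the cyclic `Ẽ[p^k]`;
`k = 1` is the tree's `frob_smul_eq_frobeniusTrace_smul_of_zsmul_eq_zero`.)
[cite: SilvermanAEC2009, Thm. V.2.3.1(b)] [cite: MazurTateTeitelbaum1986Invent, §I.11] -/
theorem iterate_eq_zsmul_of_manin (a : ℤ) (α : ℤ_[p]ˣ) (hα : ((α : ℤ_[p])) ^ 2 = a * (α : ℤ_[p]) - p)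
    {R₀ : M} {k : ℕ} (hR₀ : addOrderOf R₀ = p ^ k) (hstab : f R₀ ∈ AddSubgroup.zmultiples R₀)
    (hinj : ∀ R ∈ AddSubgroup.zmultiples R₀, f R = 0 → R = 0)
    (hrel : ∀ R ∈ AddSubgroup.zmultiples R₀, f (f R) - a • f R + (p : ℤ) • R = 0)
    (n : ℕ) (N : ℤ) (hN : (N : ℤ_[p]) - (α : ℤ_[p]) ^ n ∈ (Ideal.span {(p : ℤ_[p]) ^ k} : Ideal ℤ_[p])) :
    ∀ R ∈ AddSubgroup.zmultiples R₀, f^[n] R = N • R := by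
  obtain ⟨u, hu⟩ := exists_int_smul_of_mem_zmultiples f R₀ hstab
  intro R hR
  rw [iterate_eq_pow_smul f hu n R hR]
  -- it suffices that `p^k ∣ u^n - N`
  suffices hdvd : ((p ^ k : ℕ) : ℤ) ∣ u ^ n - N by
    obtain ⟨j, rfl⟩ := AddSubgroup.mem_zmultiples_iff.mp hR
    have hpk0 : ((p ^ k : ℕ) : ℤ) • R₀ = 0 := by
      rw [← hR₀, natCast_zsmul, addOrderOf_nsmul_eq_zero]
    have h0 : (u ^ n - N) • (j • R₀) = 0 := by
      obtain ⟨c, hc⟩ := hdvd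
      rw [hc, smul_smul, show ((p ^ k : ℕ) : ℤ) * c * j = (c * j) * ((p ^ k : ℕ) : ℤ) by ring,
        mul_smul, hpk0, smul_zero]
    rwa [sub_smul, sub_eq_zero] at h0
  rcases Nat.eq_zero_or_pos k with rfl | hk
  · simp
  -- `u` is a unit root modulo `p^k`, hence `u ≡ α`, so `u^n ≡ α^n ≡ N`
  have hcong := dvd_of_manin f hR₀ a hu hrel
  have hunit : ¬ (p : ℤ) ∣ u := not_dvd_of_injective f hk hR₀ hu hinj
  have huU : IsUnit (u : ℤ_[p]) := by
    have hlt : ¬ ‖(u : ℤ_[p])‖ < 1 := by rwa [PadicInt.norm_int_lt_one_iff_dvd]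
    exact PadicInt.isUnit_iff.mpr (le_antisymm (PadicInt.norm_le_one _) (not_lt.mp hlt))
  have hmem : (u : ℤ_[p]) ^ 2 - a * (u : ℤ_[p]) + p ∈ (Ideal.span {(p : ℤ_[p]) ^ k} : Ideal ℤ_[p]) := by
    obtain ⟨c, hc⟩ := hcong
    refine Ideal.mem_span_singleton.mpr ⟨(c : ℤ_[p]), ?_⟩
    have := congrArg (fun z : ℤ => (z : ℤ_[p])) hc
    push_cast at this
    rw [this]
  have h1 := sub_unitRoot_mem_span_pow a α hα huU hmem
  have h2 := pow_sub_pow_mem_span_pow h1 n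
  have h3 : ((u ^ n : ℤ) : ℤ_[p]) - (N : ℤ_[p]) ∈ (Ideal.span {(p : ℤ_[p]) ^ k} : Ideal ℤ_[p]) := by
    have := Submodule.sub_mem _ h2 hN
    push_cast
    convert this using 1
    ring
  exact int_dvd_of_sub_mem_span_pow h3

end Iterate



end Summit.BirchSwinnertonDyer.BirchSwinnertonDyer.Theorems.SchneiderFreeAdditiveX3

end
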